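import Mathlib

/-!
# Complement pairs: the pencil IS singular at `t = ±1`, but the `∅`-column forbids chains through `e_A + e_{S∖A}`

Helper file for crux `stmt-CriticalPhenomena-4575` (`NoHeavyLowerTail`, route `PercNearOneGluingNoHeavy`), new-inequality factory
seat `prim-ineq-gen-3` (gen 30).  Everything here is PROVED; no definitions.  Mathlib only.  Memo `CONJECTURE-J.md` §7.

The pencil rows `A ↦ (E ↦ [E ⊆ A] + t [E ∩ A = ∅])` (`E ∈ 𝒜 \\ 𝒜`) are conjecturally independent for every `t ≠ ±1` ((C0)).  The
exceptions are genuine and come from COMPLEMENT PAIRS: if all members lie in `S` and both `A` and `S \ A` are members, then on every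
difference `E ⊆ S` one has `[E ⊆ S \ A] = [E ∩ A = ∅]` and `[E ∩ (S \ A) = ∅] = [E ⊆ A]`, so the two rows are opposite at `t = −1` and
equal at `t = 1`.  CONJECTURE J (memo) says that such eigenvectors never extend to Jordan chains; the simplest instance of the
mechanism is the `∅`-column: at `t = −1` it vanishes identically, so the second chain equation `v₁ U(−1) + v₀ Y = 0` read at `E = ∅`
says `∑_A v₀(A) = 0` — which the complement-pair eigenvector `e_A + e_{S∖A}` (sum `2`) violates.

* `pencil_rows_compl_pair_neg_one` / `pencil_rows_compl_pair_one` — the two rows are opposite at `t = −1`, equal at `t = 1` (on `𝒜 \\ 𝒜`).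
* `not_linearIndependent_pencil_neg_one_of_compl_pair`, `not_linearIndependent_pencil_one_of_compl_pair` — ★ sharpness of (C0).
* `sum_eq_zero_of_chain_neg_one` — ★ every left Jordan chain `(v₀, v₁)` at `t = −1` has `∑_A v₀(A) = 0` (the `∅`-column).
* `no_chain_through_compl_pair_neg_one` — hence (when `2 ≠ 0`) the eigenvector `e_A + e_{S∖A}` heads no chain.
(prim-ineq-gen-3 gen 30, 2026-08-26.)
-/

namespace Summit.CriticalPhenomena.PercolationContinuityZ3.Theorems

namespace OrderedDifferences

open Finset
open scoped FinsetFamily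

variable {α : Type*} [DecidableEq α] {K : Type*} [Field K]

/-- Differences of a family all of whose members lie in `S` lie in `S`. -/
theorem diffs_subset_of_subset (𝒜 : Finset (Finset α)) (S : Finset α) (hS : ∀ A ∈ 𝒜, A ⊆ S) :
    ∀ E ∈ 𝒜 \\ 𝒜, E ⊆ S := by
  intro E hE
  obtain ⟨A, hA, B, _, rfl⟩ := mem_diffs.mp hE
  exact (sdiff_subset).trans (hS A hA)

/-- For `E ⊆ S`: `E ⊆ S \ A ↔ Disjoint E A` and `Disjoint E (S \ A) ↔ E ⊆ A`. -/
theorem subset_compl_iff_and_disjoint_compl_iff (S A E : Finset α) (hE : E ⊆ S) :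
    (E ⊆ S \ A ↔ Disjoint E A) ∧ (Disjoint E (S \ A) ↔ E ⊆ A) := by
  constructor
  · constructor
    · intro h
      exact disjoint_left.mpr fun x hx hxA => (mem_sdiff.mp (h hx)).2 hxA
    · intro h x hx
      exact mem_sdiff.mpr ⟨hE hx, fun hxA => disjoint_left.mp h hx hxA⟩
  · constructor
    · intro h x hx
      by_contra hxA
      exact disjoint_left.mp h hx (mem_sdiff.mpr ⟨hE hx, hxA⟩)
    · intro h
      exact disjoint_left.mpr fun x hx hxS => (mem_sdiff.mp hxS).2 (h hx)

/-- **At `t = −1` the rows of `A` and `S \ A` are opposite** on every `E ⊆ S`. -/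
theorem pencil_rows_compl_pair_neg_one (S A E : Finset α) (hE : E ⊆ S) :
    ((if E ⊆ A then (1 : K) else 0) + (-1) * (if Disjoint E A then (1 : K) else 0)) +
      ((if E ⊆ S \ A then (1 : K) else 0) + (-1) * (if Disjoint E (S \ A) then (1 : K) else 0)) = 0 := by
  obtain ⟨h1, h2⟩ := subset_compl_iff_and_disjoint_compl_iff S A E hE
  simp only [h1, h2]
  split_ifs <;> ring

/-- **At `t = 1` the rows of `A` and `S \ A` are equal** on every `E ⊆ S`. -/
theorem pencil_rows_compl_pair_one (S A E : Finset α) (hE : E ⊆ S) :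
    ((if E ⊆ A then (1 : K) else 0) + 1 * (if Disjoint E A then (1 : K) else 0)) -
      ((if E ⊆ S \ A then (1 : K) else 0) + 1 * (if Disjoint E (S \ A) then (1 : K) else 0)) = 0 := by
  obtain ⟨h1, h2⟩ := subset_compl_iff_and_disjoint_compl_iff S A E hE
  simp only [h1, h2]
  split_ifs <;> ring

/-- **(C0) is sharp at `t = −1`.**  If every member of `𝒜` lies in `S` and `A`, `S \ A` are two different members, the pencil rows at
`t = −1` are linearly dependent (`e_A + e_{S \ A}` is a left kernel vector). -/
theorem not_linearIndependent_pencil_neg_one_of_compl_pair (𝒜 : Finset (Finset α)) (S : Finset α) (hS : ∀ A ∈ 𝒜, A ⊆ S)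
    (A : Finset α) (hA : A ∈ 𝒜) (hAc : S \ A ∈ 𝒜) (hne : A ≠ S \ A) :
    ¬ LinearIndependent K (fun B : 𝒜 => fun E : (𝒜 \\ 𝒜 : Finset (Finset α)) =>
      (if (E : Finset α) ⊆ (B : Finset α) then (1 : K) else 0) +
        (-1) * (if Disjoint (E : Finset α) (B : Finset α) then (1 : K) else 0)) := by
  classical
  rw [Fintype.not_linearIndependent_iff]
  refine ⟨fun B => if (B : Finset α) = A ∨ (B : Finset α) = S \ A then 1 else 0, ?_, ⟨⟨A, hA⟩, by simp⟩⟩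
  funext E
  simp only [Finset.sum_apply, Pi.smul_apply, smul_eq_mul, Pi.zero_apply]
  have hES : (E : Finset α) ⊆ S := diffs_subset_of_subset 𝒜 S hS E E.2
  -- only the two members A and S \ A contribute
  rw [← Finset.sum_subset (subset_univ ({⟨A, hA⟩, ⟨S \ A, hAc⟩} : Finset ↥𝒜))]
  · rw [sum_pair (fun h => hne (congrArg Subtype.val h))]
    simp only [true_or, or_true, if_true, one_mul]
    exact pencil_rows_compl_pair_neg_one S A E hES
  · intro B _ hB
    rw [mem_insert, mem_singleton, not_or] at hB
    have h1 : ¬ ((B : Finset α) = A ∨ (B : Finset α) = S \ A) := by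
      rintro (h | h)
      · exact hB.1 (Subtype.ext h)
      · exact hB.2 (Subtype.ext h)
    rw [if_neg h1, zero_mul]

/-- **(C0) is sharp at `t = 1`** (over any field in which `1 ≠ −1` or not — the vector `e_A − e_{S∖A}` is non-zero regardless). -/
theorem not_linearIndependent_pencil_one_of_compl_pair (𝒜 : Finset (Finset α)) (S : Finset α) (hS : ∀ A ∈ 𝒜, A ⊆ S)
    (A : Finset α) (hA : A ∈ 𝒜) (hAc : S \ A ∈ 𝒜) (hne : A ≠ S \ A) :
    ¬ LinearIndependent K (fun B : 𝒜 => fun E : (𝒜 \\ 𝒜 : Finset (Finset α)) =>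
      (if (E : Finset α) ⊆ (B : Finset α) then (1 : K) else 0) +
        1 * (if Disjoint (E : Finset α) (B : Finset α) then (1 : K) else 0)) := by
  classical
  rw [Fintype.not_linearIndependent_iff]
  refine ⟨fun B => if (B : Finset α) = A then 1 else if (B : Finset α) = S \ A then -1 else 0, ?_, ⟨⟨A, hA⟩, by simp⟩⟩
  funext E
  simp only [Finset.sum_apply, Pi.smul_apply, smul_eq_mul, Pi.zero_apply]
  have hES : (E : Finset α) ⊆ S := diffs_subset_of_subset 𝒜 S hS E E.2
  rw [← Finset.sum_subset (subset_univ ({⟨A, hA⟩, ⟨S \ A, hAc⟩} : Finset ↥𝒜))]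
  · rw [sum_pair (fun h => hne (congrArg Subtype.val h))]
    have hne' : ¬ (S \ A = A) := fun h => hne h.symm
    simp only [if_true, hne', if_false, one_mul, neg_one_mul]
    have := pencil_rows_compl_pair_one (K := K) S A E hES
    linear_combination this
  · intro B _ hB
    rw [mem_insert, mem_singleton, not_or] at hB
    have h1 : ¬ (B : Finset α) = A := fun h => hB.1 (Subtype.ext h)
    have h2 : ¬ (B : Finset α) = S \ A := fun h => hB.2 (Subtype.ext h)
    rw [if_neg h1, if_neg h2, zero_mul]

/-- **The `∅`-column of a chain at `t = −1`.**  If `v₁ U(−1) + v₀ Y = 0` on `𝒜 \\ 𝒜` (the second equation of a left Jordan chain at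
`−1`; the first is not needed) and `𝒜` is non-empty, then `∑_A v₀(A) = 0`.  [The column `E = ∅` of `U(−1) = Z − Y` is identically
zero and `Y_∅ ≡ 1`.] -/
theorem sum_eq_zero_of_chain_neg_one (𝒜 : Finset (Finset α)) (h𝒜 : 𝒜.Nonempty) (v₀ v₁ : ↥𝒜 → K)
    (hv₁ : ∀ E ∈ 𝒜 \\ 𝒜, ∑ A : 𝒜, (v₁ A *
      ((if E ⊆ (A : Finset α) then (1 : K) else 0) + (-1) * (if Disjoint E (A : Finset α) then (1 : K) else 0)) +
        v₀ A * (if Disjoint E (A : Finset α) then (1 : K) else 0)) = 0) :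
    ∑ A : 𝒜, v₀ A = 0 := by
  obtain ⟨A0, hA0⟩ := h𝒜
  have h := hv₁ ∅ (mem_diffs.mpr ⟨A0, hA0, A0, hA0, by simp⟩)
  simpa using h

/-- **No chain through a complement-pair eigenvector.**  With `2 ≠ 0` in `K`, the `(−1)`-eigenvector `v₀ = e_A + e_{S∖A}` of
`not_linearIndependent_pencil_neg_one_of_compl_pair` heads no left Jordan chain: there is no `v₁` with `v₁ U(−1) + v₀ Y = 0`. -/
theorem no_chain_through_compl_pair_neg_one (𝒜 : Finset (Finset α)) (h2 : (2 : K) ≠ 0)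
    (A : Finset α) (hA : A ∈ 𝒜) (S : Finset α) (hAc : S \ A ∈ 𝒜) (hne : A ≠ S \ A) (v₁ : ↥𝒜 → K)
    (hv₁ : ∀ E ∈ 𝒜 \\ 𝒜, ∑ B : 𝒜, (v₁ B *
      ((if E ⊆ (B : Finset α) then (1 : K) else 0) + (-1) * (if Disjoint E (B : Finset α) then (1 : K) else 0)) +
        (if (B : Finset α) = A ∨ (B : Finset α) = S \ A then (1 : K) else 0) *
          (if Disjoint E (B : Finset α) then (1 : K) else 0)) = 0) :
    False := by
  classical
  have h := sum_eq_zero_of_chain_neg_one 𝒜 ⟨A, hA⟩ (fun B => if (B : Finset α) = A ∨ (B : Finset α) = S \ A then (1 : K) else 0)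
    v₁ hv₁
  rw [← Finset.sum_subset (subset_univ ({⟨A, hA⟩, ⟨S \ A, hAc⟩} : Finset ↥𝒜))] at h
  · rw [sum_pair (fun h' => hne (congrArg Subtype.val h'))] at h
    simp only [true_or, or_true, if_true] at h
    exact h2 (by linear_combination h)
  · intro B _ hB
    rw [mem_insert, mem_singleton, not_or] at hB
    have h1 : ¬ ((B : Finset α) = A ∨ (B : Finset α) = S \ A) := by
      rintro (h' | h')
      · exact hB.1 (Subtype.ext h')
      · exact hB.2 (Subtype.ext h')
    rw [if_neg h1]

end OrderedDifferences

end Summit.CriticalPhenomena.PercolationContinuityZ3.Theorems
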